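import Mathlib.Algebra.BigOperators.Group.List.Basic
import Literature.Probability.RandomPlanarGeometry.USTPeanoManhattan
import HarnessLib

/-!
# A closed primal lattice walk and a closed dual lattice walk cross an even number of times

Support for the existence of UST Peano paths ([LSW04] §4.1, `USTPeanoPeeling.lean`): the only
global ("Jordan curve") input of the combinatorial argument there is the following parity fact
about the square lattice `ℤ²` and its dual `(1/2 + ℤ)²`. A closed walk `A = (v₀, …, v_k = v₀)` in
the primal grid and a closed walk `B = (w₀, …, w_l = w₀)` in the dual grid, counted with
multiplicity, have an EVEN number of pairs (edge of `A`, edge of `B`) which are dual to each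
other (`IsDualPair`, i.e. which intersect): `crossings_mod_two`.

Proof (discrete Stokes, no topology). Let `F(v)` be the number of vertical edges of `B` crossing
the horizontal line through the primal vertex `v` strictly to the left of `v` (`leftCount`). For a
horizontal primal edge `[v, v']` the number of `B`-edges dual to it is `|F(v') - F(v)|`; for a
vertical primal edge `[v, v']`, `v' = v + (0, 1)`, it has the parity of `F(v) + F(v')`, because the
edges of the closed walk `B` with exactly one endpoint in the half-row
`{w : w₂ = v₂, w₁ < v₁}` of dual vertices are: the vertical ones counted by `F(v)` and `F(v')`,
and the horizontal one dual to `[v, v']`; and a closed walk leaves a set as often as it enters it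
(`sum_zip_tail_telescope`). Both cases are one pointwise parity identity
(`pointwise_mod_two`, linear arithmetic). Summing over the edges of the closed walk `A`, every
`F(vᵢ)` is counted twice (`sum_zip_tail_fst`, `sum_zip_tail_snd`).

Also: the elementary `List` lemmas about sums along the consecutive pairs `l.zip l.tail` of a
list used here and downstream.
-/

namespace Literature.Probability.RandomPlanarGeometry

namespace USTPeano

/-! ### Sums along the consecutive pairs of a list -/

section ListLemmas

variable {X : Type*}

/-- The consecutive pairs of `x :: y :: l`. [folklore] -/
theorem zip_tail_cons_cons (x y : X) (l : List X) :
    (x :: y :: l).zip (x :: y :: l).tail = (x, y) :: ((y :: l).zip (y :: l).tail) := rfl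

/-- A one-element list has no consecutive pairs. [folklore] -/
theorem zip_tail_singleton (x : X) : [x].zip [x].tail = [] := rfl

/-- Summing `g` over the first components of the consecutive pairs misses only the last element.
[folklore] -/
theorem sum_zip_tail_fst (g : X → ℤ) :
    ∀ (l : List X) (h : l ≠ []),
      ((l.zip l.tail).map fun e ↦ g e.1).sum + g (l.getLast h) = (l.map g).sum
  | [], h => absurd rfl h
  | [x], _ => by simp
  | x :: y :: l, _ => by
    rw [zip_tail_cons_cons, List.map_cons, List.sum_cons, List.getLast_cons (List.cons_ne_nil y l),
      List.map_cons, List.sum_cons, add_assoc, sum_zip_tail_fst g (y :: l) (List.cons_ne_nil y l)]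

/-- Summing `g` over the second components of the consecutive pairs misses only the head.
[folklore] -/
theorem sum_zip_tail_snd (g : X → ℤ) :
    ∀ (l : List X) (h : l ≠ []),
      ((l.zip l.tail).map fun e ↦ g e.2).sum + g (l.head h) = (l.map g).sum
  | [], h => absurd rfl h
  | [x], _ => by simp
  | x :: y :: l, _ => by
    rw [zip_tail_cons_cons, List.map_cons, List.sum_cons, List.head_cons, List.map_cons,
      List.sum_cons]
    have := sum_zip_tail_snd g (y :: l) (List.cons_ne_nil y l)
    rw [List.head_cons] at this
    rw [← this]
    ring

/-- **Telescoping along a list.** [folklore] -/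
theorem sum_zip_tail_telescope (g : X → ℤ) :
    ∀ (l : List X) (h : l ≠ []),
      ((l.zip l.tail).map fun e ↦ g e.1 - g e.2).sum = g (l.head h) - g (l.getLast h)
  | [], h => absurd rfl h
  | [x], _ => by simp
  | x :: y :: l, _ => by
    rw [zip_tail_cons_cons, List.map_cons, List.sum_cons, List.head_cons,
      List.getLast_cons (List.cons_ne_nil y l),
      sum_zip_tail_telescope g (y :: l) (List.cons_ne_nil y l), List.head_cons]
    ring

/-- **A closed walk enters a set as often as it leaves it**: for a list with equal ends, the sum
of `g` over the sources of its consecutive pairs equals the sum over the targets. [folklore] -/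
theorem sum_zip_tail_fst_eq_snd (g : X → ℤ) (l : List X) (h : l ≠ []) (hcl : l.head h = l.getLast h) :
    ((l.zip l.tail).map fun e ↦ g e.1).sum = ((l.zip l.tail).map fun e ↦ g e.2).sum := by
  have h1 := sum_zip_tail_fst g l h
  have h2 := sum_zip_tail_snd g l h
  rw [hcl] at h2
  linarith

/-- The consecutive pairs of a chain are related. [folklore] -/
theorem forall_zip_tail_of_isChain {R : X → X → Prop} :
    ∀ {l : List X}, l.IsChain R → ∀ e ∈ l.zip l.tail, R e.1 e.2
  | [], _ => by simp
  | [x], _ => by simp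
  | x :: y :: l, h => by
    rw [List.isChain_cons_cons] at h
    intro e he
    rw [zip_tail_cons_cons, List.mem_cons] at he
    rcases he with rfl | he
    · exact h.1
    · exact forall_zip_tail_of_isChain h.2 e he

/-- A sum of even integers is even. [folklore] -/
theorem sum_mod_two_of_forall : ∀ (l : List ℤ), (∀ x ∈ l, x % 2 = 0) → l.sum % 2 = 0
  | [], _ => by simp
  | x :: l, h => by
    rw [List.sum_cons]
    have hx := h x (by simp)
    have hl := sum_mod_two_of_forall l fun y hy ↦ h y (by simp [hy])
    omega

/-- A sum of terms all equal to zero vanishes (`List.sum` of a `map`). [folklore] -/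
theorem sum_map_eq_zero_of_forall {Y : Type*} (l : List Y) (g : Y → ℤ) (h : ∀ y ∈ l, g y = 0) :
    (l.map g).sum = 0 :=
  List.sum_eq_zero fun x hx ↦ by
    obtain ⟨y, hy, rfl⟩ := List.mem_map.1 hx
    exact h y hy

end ListLemmas

/-! ### The crossing count and the height function -/

/-- **The number of crossings** of the primal walk `A` with the dual walk `B`: the number of
pairs (edge of `A`, edge of `B`), with multiplicity, which are dual to each other. [folklore] -/
def crossings (A B : List (ℤ × ℤ)) : ℤ :=
  ((A.zip A.tail).map fun e ↦
    ((B.zip B.tail).map fun f ↦ if IsDualPair e.1 e.2 f.1 f.2 then (1 : ℤ) else 0).sum).sum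

/-- The dual edge `f = [w, w']` is vertical and crosses the horizontal line through the primal
vertex `v` (i.e. `max w₂ w'₂ = v₂`) strictly to the left of `v` (`w₁ + ½ < v₁`). [folklore] -/
def LeftCross (v : ℤ × ℤ) (f : (ℤ × ℤ) × (ℤ × ℤ)) : Prop :=
  f.1.1 = f.2.1 ∧ f.1.1 < v.1 ∧ ((f.2.2 = f.1.2 + 1 ∧ f.2.2 = v.2) ∨ (f.1.2 = f.2.2 + 1 ∧ f.1.2 = v.2))

/-- `LeftCross` is decidable. [folklore] -/
instance (v : ℤ × ℤ) (f : (ℤ × ℤ) × (ℤ × ℤ)) : Decidable (LeftCross v f) := by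
  unfold LeftCross; infer_instance

/-- **The height function** `F(v)`: the number of edges of `B` which are vertical and cross the
horizontal line through `v` strictly left of `v`. [folklore] -/
def leftCount (B : List (ℤ × ℤ)) (v : ℤ × ℤ) : ℤ :=
  ((B.zip B.tail).map fun f ↦ if LeftCross v f then (1 : ℤ) else 0).sum

/-- The half-row of dual vertices attached to a VERTICAL directed primal edge `[u, u']`: the dual
vertices `w` on the row between `u` and `u'` (`w₂ = min u₂ u'₂`) strictly left of the edge; empty
for a horizontal edge. [folklore] -/
def InHalfRow (u u' w : ℤ × ℤ) : Prop :=
  (u'.1 = u.1 ∧ u'.2 = u.2 + 1 ∧ w.2 = u.2 ∧ w.1 < u.1) ∨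
    (u.1 = u'.1 ∧ u.2 = u'.2 + 1 ∧ w.2 = u'.2 ∧ w.1 < u'.1)

/-- `InHalfRow` is decidable. [folklore] -/
instance (u u' w : ℤ × ℤ) : Decidable (InHalfRow u u' w) := by
  unfold InHalfRow; infer_instance

/-- The summand of the pointwise parity identity (`pointwise_mod_two`). [folklore] -/
def pwTerm (u u' w w' : ℤ × ℤ) : ℤ :=
  (if IsDualPair u u' w w' then (1 : ℤ) else 0) + (if LeftCross u (w, w') then (1 : ℤ) else 0) +
    (if LeftCross u' (w, w') then (1 : ℤ) else 0) +
      ((if InHalfRow u u' w then (1 : ℤ) else 0) - (if InHalfRow u u' w' then (1 : ℤ) else 0))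

/-- The summand is symmetric in the primal edge. [folklore] -/
theorem pwTerm_symm (u u' w w' : ℤ × ℤ) : pwTerm u' u w w' = pwTerm u u' w w' := by
  have h1 : IsDualPair u' u w w' ↔ IsDualPair u u' w w' := ⟨fun h ↦ h.symm_left, fun h ↦ h.symm_left⟩
  have h2 : ∀ z, InHalfRow u' u z ↔ InHalfRow u u' z := fun z ↦ by unfold InHalfRow; tauto
  unfold pwTerm
  rw [if_congr h1 rfl rfl, if_congr (h2 w) rfl rfl, if_congr (h2 w') rfl rfl]
  ring

/-- The pointwise parity identity for a horizontal primal edge traversed rightwards. [folklore] -/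
theorem pwTerm_mod_two_h (x y : ℤ) (w w' : ℤ × ℤ) (hw : LatticeAdj w w') :
    pwTerm (x, y) (x + 1, y) w w' % 2 = 0 := by
  obtain ⟨c, r⟩ := w; obtain ⟨c', r'⟩ := w'
  simp only [LatticeAdj] at hw
  rcases hw with ⟨rfl, rfl | rfl⟩ | ⟨rfl, rfl | rfl⟩ <;>
    simp only [pwTerm, IsDualPair, LeftCross, InHalfRow, LatticeAdj, true_and, and_true, true_or,
      or_true] <;> split_ifs <;> omega

/-- The pointwise parity identity for a vertical primal edge traversed upwards. [folklore] -/
theorem pwTerm_mod_two_v (x y : ℤ) (w w' : ℤ × ℤ) (hw : LatticeAdj w w') :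
    pwTerm (x, y) (x, y + 1) w w' % 2 = 0 := by
  obtain ⟨c, r⟩ := w; obtain ⟨c', r'⟩ := w'
  simp only [LatticeAdj] at hw
  rcases hw with ⟨rfl, rfl | rfl⟩ | ⟨rfl, rfl | rfl⟩ <;>
    simp only [pwTerm, IsDualPair, LeftCross, InHalfRow, LatticeAdj, true_and, and_true, true_or,
      or_true] <;> split_ifs <;> omega

/-- **The pointwise parity identity.** For a primal edge `[u, u']` and a dual edge `[w, w']`:
`[dual pair] + [w w' counted in F(u)] + [w w' counted in F(u')] ≡ [w ∈ R] - [w' ∈ R] (mod 2)`,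
`R` the half-row of `[u, u']`. (Horizontal `[u, u']`, `u' = u + (1, 0)`: the dual edge in column
`u₁` is the dual pair, those in columns `< u₁` are counted twice. Vertical: the edges with exactly
one endpoint in `R` are the vertical ones counted by `F(u)`, `F(u')` and the horizontal dual
pair.) [folklore] -/
theorem pointwise_mod_two (u u' w w' : ℤ × ℤ) (hu : LatticeAdj u u') (hw : LatticeAdj w w') :
    pwTerm u u' w w' % 2 = 0 := by
  obtain ⟨x, y⟩ := u; obtain ⟨x', y'⟩ := u'
  simp only [LatticeAdj] at hu
  rcases hu with ⟨rfl, rfl | rfl⟩ | ⟨rfl, rfl | rfl⟩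
  · exact pwTerm_mod_two_v x y w w' hw
  · rw [← pwTerm_symm]; exact pwTerm_mod_two_v x y' w w' hw
  · exact pwTerm_mod_two_h x y w w' hw
  · rw [← pwTerm_symm]; exact pwTerm_mod_two_h x' y w w' hw

/-- **One edge of `A`**: the number of `B`-edges dual to the primal edge `[u, u']` has the parity
of `F(u) + F(u')` when `B` is a closed dual walk. [folklore] -/
theorem rowSum_mod_two (u u' : ℤ × ℤ) (hu : LatticeAdj u u') {B : List (ℤ × ℤ)} (hB : B ≠ [])
    (hBc : B.IsChain LatticeAdj) (hBcl : B.head hB = B.getLast hB) :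
    (((B.zip B.tail).map fun f ↦ if IsDualPair u u' f.1 f.2 then (1 : ℤ) else 0).sum +
        leftCount B u + leftCount B u') % 2 = 0 := by
  -- the telescoping sum over the half-row vanishes
  have htel : ((B.zip B.tail).map fun f ↦ ((if InHalfRow u u' f.1 then (1 : ℤ) else 0) -
      (if InHalfRow u u' f.2 then (1 : ℤ) else 0))).sum = 0 := by
    rw [sum_zip_tail_telescope (fun w ↦ if InHalfRow u u' w then (1 : ℤ) else 0) B hB, hBcl, sub_self]
  -- the sum of the pointwise-even terms is even
  have heven : (((B.zip B.tail).map fun f ↦ pwTerm u u' f.1 f.2).sum) % 2 = 0 := by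
    refine sum_mod_two_of_forall _ fun x hx ↦ ?_
    obtain ⟨f, hf, rfl⟩ := List.mem_map.1 hx
    exact pointwise_mod_two u u' f.1 f.2 hu (forall_zip_tail_of_isChain hBc f hf)
  simp only [pwTerm] at heven
  rw [List.sum_map_add, List.sum_map_add, List.sum_map_add, htel, add_zero] at heven
  exact heven

/-- **Parity lemma.** A closed walk in the primal grid and a closed walk in the dual grid have an
even number of mutually dual (i.e. intersecting) pairs of edges, counted with multiplicity.
[folklore] -/
theorem crossings_mod_two {A B : List (ℤ × ℤ)} (hA : A ≠ []) (hAc : A.IsChain LatticeAdj)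
    (hAcl : A.head hA = A.getLast hA) (hB : B ≠ []) (hBc : B.IsChain LatticeAdj)
    (hBcl : B.head hB = B.getLast hB) : crossings A B % 2 = 0 := by
  -- sum the one-edge congruences over the edges of `A`
  have hsum : (((A.zip A.tail).map fun e ↦
      (((B.zip B.tail).map fun f ↦ if IsDualPair e.1 e.2 f.1 f.2 then (1 : ℤ) else 0).sum +
        leftCount B e.1 + leftCount B e.2)).sum) % 2 = 0 := by
    refine sum_mod_two_of_forall _ fun x hx ↦ ?_
    obtain ⟨e, he, rfl⟩ := List.mem_map.1 hx
    exact rowSum_mod_two e.1 e.2 (forall_zip_tail_of_isChain hAc e he) hB hBc hBcl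
  rw [List.sum_map_add, List.sum_map_add] at hsum
  -- every `F(vᵢ)` appears twice
  have htwice := sum_zip_tail_fst_eq_snd (leftCount B) A hA hAcl
  unfold crossings
  omega

end USTPeano

end Literature.Probability.RandomPlanarGeometry
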